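/-
Copyright (c) 2026 the pub-hodgecm-mathlib formalisation cell (harness21).  Prover seat hodgecm-mathlib-F0P3a-p09 (g8): line LH3 (closer stub `stub_N9`), LETTER L3′, SURJ-OF-FORWARD road
(RULINGS #22∕#23), sliver (Σ4-img) «THE CLASS IMAGE OF A CHART IS CLOSED» (offered by F0P3a-p04 (g25) 2026-09-02T12:51:49Z; SURJ binder LH10-p01 (g5)).
-/
import Literature.NumberTheory.Rogawski1990.ArchBouazizClassMap          -- ★ p851469 (LH10-p01 (g5)): `bzClassMap`, `bzClassMap_of_mem ∕ _of_not_mem ∕ _congr`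
import Mathlib.Analysis.SpecialFunctions.Trigonometric.DerivHyp         -- `Real.one_le_cosh`
import HarnessLib

/-!
# The class image of an `H_∞`-chart is CLOSED: `IsClosed (Set.range (bzClassMap S))`
# (Bouaziz 1994 §2.3, §5.1; Rogawski 1990 §3.6, §8.2)

Topic `NumberTheory/Rogawski1990`; namespace `Literature.NumberTheory.Rogawski1990`.  THEOREMS ONLY (no `def`, no instance, no notation, no axiom, no named fact, no `sorry`).
Cell `pub/hodgecm-mathlib`, crux H413 (`stmt-HodgeConjecture-24833`), line LH3 (closer stub `stub_N9`), letter L3′, SURJ-OF-FORWARD road (RULINGS #22∕#23; binder LH10-p01 (g5)),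
organ (Σ-LOCAL) at REGULAR base classes = (Σ4) «REGULAR GERMS» (F0P3a-p04 (g25)): sliver **(Σ4-img)** — the set of class data of the chart `S`, `Set.range (bzClassMap S)`, is CLOSED in
`W → ℂ × ℂ × ℂ`, so a base class `b` OFF the image of a chart type has a positive distance from it (the «wrong chart type sees nothing near `b`» step of (Σ4d)).  Count-neutral.

THE MATHEMATICS (group-free, any `[Fintype W] [DecidableEq W]`).  The class map ★ `bzClassMap S c w = (tr γ_w(c), det γ_w(c), e^{i c_{w,1}})` reads the place `w` only through
`c w` (★ `bzClassMap_congr`), so its range is the PRODUCT over the places of the per-place ranges (§2 `range_bzClassMap_eq_pi`; Mathlib `isClosed_set_pi`).  At a compact place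
`w ∉ S` the per-place map `t ↦ (e^{it₀} + e^{it₂}, e^{it₀}e^{it₂}, e^{it₁})` factors through the COMPACT torus `(Fin 3 → Circle)` (`Circle.exp` is onto, Mathlib `Circle.exp_surjective`),
so its range is compact, hence closed (§1 `isCompact_range_bzClassMap_const_of_not_mem`).  At a split place `w ∈ S` the per-place map `t ↦ ((e^{x}+e^{−x})e^{iθ}, e^{2iθ}, e^{it₁})`
(`x = t₀`, `θ = t₂`) has the EXPLICIT closed range `{p | 2 ≤ ‖p₁‖ ∧ p₁² = ‖p₁‖²·p₂ ∧ ‖p₃‖ = 1}` (§1 `range_bzClassMap_const_of_mem`: «⊆» since `eˣ + e⁻ˣ = 2cosh x ≥ 2` and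
`|e^{iθ}| = 1`; «⊇» with `s = ‖p₁‖`, `x = log((s + √(s²−4))∕2)` — so `eˣ + e⁻ˣ = s` —, `e^{iθ} = p₁∕s`, `e^{it₁} = p₃` by `Circle.exp_surjective`); three closed conditions.
HONEST LABEL: topology bookkeeping for the SURJ road; L3′ stays XL∕PRINT-labelled ((Σ5) PRINT, RULING #23) until paid; HC_CM is proved only modulo the 7 printed citations (2 remaining:
hLiu418 = `stmt-HodgeConjecture-24832`, h413 = `stmt-HodgeConjecture-24833`) until rung 0 closes; this file moves no row of the books.

## References
* [Bouaziz1994IntegralesOrbitales] A. Bouaziz, *Intégrales orbitales sur les groupes de Lie réductifs*, Ann. Sci. ÉNS (4) 27 (1994) 573–609, §2.3 Lemme 2.3.1, §5.1 p. 588.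
* [Rogawski1990] J. D. Rogawski, *Automorphic Representations of Unitary Groups in Three Variables*, Ann. of Math. Stud. 123 (1990), §3.6 p. 31; §8.2 p. 122.
-/

set_option autoImplicit false

noncomputable section

open Complex Set Function

namespace Literature.NumberTheory.Rogawski1990

variable {W : Type*} [DecidableEq W]

/-! ## §1 The per-place ranges -/

omit [DecidableEq W] in
/-- `eˣ + e⁻ˣ ≥ 2` (`= 2cosh x`, Mathlib `Real.one_le_cosh`). [cite: Rogawski1990, §3.6 p. 31] -/
private theorem two_le_exp_add_exp_neg (x : ℝ) : 2 ≤ Real.exp x + Real.exp (-x) := by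
  have h := Real.one_le_cosh x
  rw [Real.cosh_eq] at h
  linarith

/-- **COMPACT PLACE: the per-place class range is COMPACT** — `t ↦ (e^{it₀} + e^{it₂}, e^{it₀}e^{it₂}, e^{it₁})` factors through the compact torus `Fin 3 → Circle` (`Circle.exp` onto).
[cite: Rogawski1990, §8.2 p. 122] [cite: Bouaziz1994IntegralesOrbitales, §5.1 p. 588] -/
theorem isCompact_range_bzClassMap_const_of_not_mem {S : Finset W} {w : W} (hw : w ∉ S) :
    IsCompact (Set.range fun t : Fin 3 → ℝ => bzClassMap S (fun _ : W => t) w) := by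
  have hfun : (fun t : Fin 3 → ℝ => bzClassMap S (fun _ : W => t) w) =
      (fun z : Fin 3 → Circle => (((z 0 : ℂ)) + (z 2 : ℂ), ((z 0 : ℂ)) * (z 2 : ℂ), (z 1 : ℂ))) ∘ fun t : Fin 3 → ℝ => fun i => Circle.exp (t i) := by
    funext t
    rw [bzClassMap_of_not_mem hw]
    rfl
  have hsurj : Surjective fun t : Fin 3 → ℝ => fun i => Circle.exp (t i) := by
    intro z
    choose t ht using fun i => Circle.exp_surjective (z i)
    exact ⟨t, funext ht⟩
  rw [hfun, Set.range_comp, hsurj.range_eq, Set.image_univ]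
  have hc : ∀ i : Fin 3, Continuous fun z : Fin 3 → Circle => ((z i : Circle) : ℂ) := fun i => continuous_subtype_val.comp (continuous_apply i)
  exact isCompact_range (((hc 0).add (hc 2)).prodMk (((hc 0).mul (hc 2)).prodMk (hc 1)))

/-- **SPLIT PLACE: the per-place class range is the EXPLICIT closed set `{p | 2 ≤ ‖p₁‖ ∧ p₁² = ‖p₁‖²·p₂ ∧ ‖p₃‖ = 1}`** (`p₁ = (eˣ+e⁻ˣ)e^{iθ}`, `p₂ = e^{2iθ}`, `p₃ = e^{it₁}`;
inverse: `s = ‖p₁‖`, `x = log((s + √(s² − 4))∕2)`, `e^{iθ} = p₁∕s`). [cite: Rogawski1990, §3.6 p. 31] [cite: Bouaziz1994IntegralesOrbitales, §5.1 p. 588] -/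
theorem range_bzClassMap_const_of_mem {S : Finset W} {w : W} (hw : w ∈ S) :
    Set.range (fun t : Fin 3 → ℝ => bzClassMap S (fun _ : W => t) w) =
      {p : ℂ × ℂ × ℂ | 2 ≤ ‖p.1‖ ∧ p.1 ^ 2 = (((‖p.1‖ ^ 2 : ℝ)) : ℂ) * p.2.1 ∧ ‖p.2.2‖ = 1} := by
  ext p
  simp only [Set.mem_range, Set.mem_setOf_eq, bzClassMap_of_mem hw]
  constructor
  · rintro ⟨t, rfl⟩
    have hs : 2 ≤ Real.exp (t 0) + Real.exp (-(t 0)) := two_le_exp_add_exp_neg (t 0)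
    have hs0 : 0 ≤ Real.exp (t 0) + Real.exp (-(t 0)) := by linarith
    have hnorm : ‖(((Real.exp (t 0) + Real.exp (-(t 0)) : ℝ) : ℂ)) * (Circle.exp (t 2) : ℂ)‖ = Real.exp (t 0) + Real.exp (-(t 0)) := by
      rw [norm_mul, Complex.norm_of_nonneg hs0, Circle.norm_coe, mul_one]
    refine ⟨by rw [hnorm]; exact hs, ?_, Circle.norm_coe _⟩
    rw [hnorm]
    push_cast
    ring
  · rintro ⟨h2, hsq, h3⟩
    -- the modulus `s = ‖p₁‖ ≥ 2` and `x = log((s + √(s² − 4))/2)` with `eˣ + e⁻ˣ = s`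
    set s : ℝ := ‖p.1‖ with hsdef
    have hs0 : 0 < s := by linarith
    have hdisc : 0 ≤ s ^ 2 - 4 := by nlinarith
    set y : ℝ := (s + Real.sqrt (s ^ 2 - 4)) / 2 with hydef
    have hy0 : 0 < y := by have := Real.sqrt_nonneg (s ^ 2 - 4); rw [hydef]; linarith
    have hyinv : y * ((s - Real.sqrt (s ^ 2 - 4)) / 2) = 1 := by
      rw [hydef]
      nlinarith [Real.sq_sqrt hdisc]
    have hexp : Real.exp (Real.log y) + Real.exp (-Real.log y) = s := by
      rw [Real.exp_neg, Real.exp_log hy0, show y⁻¹ = (s - Real.sqrt (s ^ 2 - 4)) / 2 from (eq_inv_of_mul_eq_one_right hyinv).symm, hydef]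
      ring
    -- the unit `u = p₁ / s` on the circle and the two angles
    have hp1 : p.1 ≠ 0 := by
      intro h0; rw [hsdef, h0, norm_zero] at h2; linarith
    have hu : ‖p.1 / (s : ℂ)‖ = 1 := by
      rw [norm_div, Complex.norm_of_nonneg hs0.le, hsdef, div_self (norm_ne_zero_iff.2 hp1)]
    obtain ⟨θ, hθ⟩ := Circle.exp_surjective ⟨p.1 / (s : ℂ), mem_sphere_zero_iff_norm.2 hu⟩
    obtain ⟨b, hb⟩ := Circle.exp_surjective ⟨p.2.2, mem_sphere_zero_iff_norm.2 h3⟩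
    have hθ' : (Circle.exp θ : ℂ) = p.1 / (s : ℂ) := by rw [hθ]
    have hb' : (Circle.exp b : ℂ) = p.2.2 := by rw [hb]
    have hsC : (s : ℂ) ≠ 0 := by exact_mod_cast hs0.ne'
    refine ⟨![Real.log y, b, θ], ?_⟩
    simp only [Matrix.cons_val_zero, Matrix.cons_val_one, Matrix.cons_val_two, Matrix.head_cons, Matrix.tail_cons]
    rw [hexp, hθ', hb']
    refine Prod.ext ?_ (Prod.ext ?_ rfl)
    · show (s : ℂ) * (p.1 / (s : ℂ)) = p.1
      field_simp
    · show (p.1 / (s : ℂ)) ^ 2 = p.2.1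
      rw [div_pow, hsq]
      push_cast
      field_simp

/-- **SPLIT PLACE: the per-place class range is CLOSED** (three closed conditions). [cite: Rogawski1990, §3.6 p. 31] -/
theorem isClosed_range_bzClassMap_const_of_mem {S : Finset W} {w : W} (hw : w ∈ S) :
    IsClosed (Set.range fun t : Fin 3 → ℝ => bzClassMap S (fun _ : W => t) w) := by
  rw [range_bzClassMap_const_of_mem hw]
  have h1 : Continuous fun p : ℂ × ℂ × ℂ => ‖p.1‖ := continuous_norm.comp continuous_fst
  refine (isClosed_le continuous_const h1).inter ((isClosed_eq (continuous_fst.pow 2)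
    ((Complex.continuous_ofReal.comp (h1.pow 2)).mul (continuous_fst.comp continuous_snd))).inter
      (isClosed_eq (continuous_norm.comp (continuous_snd.comp continuous_snd)) continuous_const))

/-- Either way the per-place class range is closed. [cite: Bouaziz1994IntegralesOrbitales, §5.1 p. 588] -/
theorem isClosed_range_bzClassMap_const (S : Finset W) (w : W) :
    IsClosed (Set.range fun t : Fin 3 → ℝ => bzClassMap S (fun _ : W => t) w) := by
  by_cases hw : w ∈ S
  · exact isClosed_range_bzClassMap_const_of_mem hw
  · exact (isCompact_range_bzClassMap_const_of_not_mem hw).isClosed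

/-! ## §2 The range of the class map is the product of the per-place ranges, hence closed -/

/-- **The class image of the chart `S` is the PRODUCT of the per-place ranges** (the class map reads `w` only through `c w`, ★ `bzClassMap_congr`).
[cite: Bouaziz1994IntegralesOrbitales, §2.3 p. 578; §5.1 p. 588] -/
theorem range_bzClassMap_eq_pi (S : Finset W) :
    Set.range (bzClassMap S) = Set.pi Set.univ fun w : W => Set.range fun t : Fin 3 → ℝ => bzClassMap S (fun _ : W => t) w := by
  ext F
  simp only [Set.mem_range, Set.mem_pi, Set.mem_univ, forall_const]
  constructor
  · rintro ⟨c, rfl⟩ w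
    exact ⟨c w, bzClassMap_congr S rfl⟩
  · intro h
    choose t ht using h
    exact ⟨fun w => t w, funext fun w => (bzClassMap_congr S (c' := fun _ : W => t w) rfl).trans (ht w)⟩

/-- **(Σ4-img) THE CLASS IMAGE OF A CHART IS CLOSED**: `Set.range (bzClassMap S)` is closed in `W → ℂ × ℂ × ℂ` — product of closed per-place ranges (Mathlib `isClosed_set_pi`; §1).
So a base class off the image of the chart type `S` is at positive distance from every class datum of that chart ((Σ4d)'s chart-type selection).
[cite: Bouaziz1994IntegralesOrbitales, §2.3 Lemme 2.3.1; §5.1 p. 588] [cite: Rogawski1990, §3.6 p. 31; §8.2 p. 122] -/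
theorem isClosed_range_bzClassMap [Fintype W] (S : Finset W) : IsClosed (Set.range (bzClassMap S)) := by
  rw [range_bzClassMap_eq_pi]
  exact isClosed_set_pi fun w _ => isClosed_range_bzClassMap_const S w

end Literature.NumberTheory.Rogawski1990

end
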